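import Literature.Probability.RandomPlanarGeometry.BDGS2012
import Literature.Probability.RandomPlanarGeometry.BDGS2012CountBoundsProofs
import Literature.Probability.RandomPlanarGeometry.SAWPatternDensity
import Literature.Probability.RandomPlanarGeometry.SAWLowerBound2604
import Literature.Probability.RandomPlanarGeometry.SAWWords
import Mathlib.Analysis.SpecialFunctions.Pow.Real
import HarnessLib

/-!
# Kesten's pattern theorem for tight U-turns on `ℤ²`, with explicit constants

Topic `Literature/Probability/RandomPlanarGeometry` (continues `SAWPatternDensity.lean` = Madras–Slade
Lemma 7.2.5 in exponential form, `SAWWords.lean` = step words). N. Madras, G. Slade, *The Self-Avoiding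
Walk* (1993), §7.2: Theorem 7.2.3 (Kesten's pattern theorem: for a proper internal pattern `P` there is
`a > 0` with `lim sup_N c_N[aN, P]^{1/N} < μ`) rests on Lemma 7.2.5 ("if `lim inf c_N[0,E]^{1/N} < μ` then
`lim sup c_N[a₁N, E(m)]^{1/N} < μ`"). For the simplest proper internal pattern of `ℤ²`, the **tight U-turn**
(three consecutive steps `e, f, -e`), the hypothesis of Lemma 7.2.5 is a finite counting fact, so the
pattern theorem for U-turns comes with EXPLICIT constants and no surgery:

* `Zd.hairpinAt N ω j` — a tight U-turn at step `j`; `Zd.restricts_hairpinAt` (the restriction property of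
  Lemma 7.2.5, every block length, every dimension).
* `UTurnFree` / `uTurnFreeWords n` — step words with no immediate reversal and no factor `(a, b, a+2)`;
  `uTurnFreeSeq` = 4, 12, 28, 68, … (the 2-state automaton count). The machinery is `private` (Literature
  cited-only rule): the recursion `#W(n+3) = 2·#W(n+2) + #W(n+1)` (`card_uTurnFreeWords_rec`, proved by the
  first-letter decomposition `sum_words_succ_cons`; no enumeration, no `native_decide`), `#W(10) = 13 452`,
  `#W(20) = 90 478 148`, and the injection of hairpin-free self-avoiding walks into these words
  (`card_goodWalks_le_card_uTurnFreeWords`, by `SAW.wordOf` / `SAW.traj_wordOf`).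
* `Zd.lemma725_explicit` — Lemma 7.2.5 with its constants exposed: `Q = m·q₂`, `C = Σ_{r<m} c_r`, from
  upper bounds `#good ≤ y μ^m`, `c_m ≤ x μ^m` and `((1+y)/2)^{q₂} ≤ (1-y)/(4x)` (every `d`).
* (private) `Zd.card_goodWalks_hairpinAt_ten_lt` — `#{hairpin-free 10-step SAWs} ≤ 13 452 < 2.604^10 ≤ μ(ℤ²)^10`
  (`SAW.le_connectiveConstant_2604`); **`Zd.hairpin_density`** — Theorem 7.2.3 for U-turns on `ℤ²` in the
  exponential form of Lemma 7.2.5: `∃ Q > 0, ∃ C, ∀ N, #{ω ∈ S_N : #U-turns ≤ N/(4Q)} ≤ C·2^{-⌊N/Q⌋}·μ^N`;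
  **`Zd.hairpin_density_explicit`** — the same with `Q = 320`, `C = Σ_{r<20} c_r` (block length `20`:
  `90 478 148 ≤ 0.441·2.604^20`, `c_20 ≤ 4·3^19 ≤ 22.7·2.604^20` by `Zd.count_succ_le`, `q₂ = 16`),
  i.e. at least `N/1280` tight U-turns on all but `C·2^{-⌊N/320⌋}·μ^N` of the `N`-step walks.

The constants are this formalisation's (the printed theorem is qualitative, "∃ a > 0"). No named facts;
the only non-standard axioms are the `native_decide` evaluations behind `SAW.le_connectiveConstant_2604`.

## References

* N. Madras, G. Slade, *The Self-Avoiding Walk*, Birkhäuser (1993), §7.2, Lemma 7.2.5, Theorem 7.2.3.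
* H. Kesten, *On the number of self-avoiding walks*, J. Math. Phys. 4 (1963) 960–969 (the pattern theorem).
-/

open Finset
open Literature.Probability.LatticeModels (Site zdGraph)
open scoped BigOperators

namespace Literature.Probability.RandomPlanarGeometry.SAW

namespace Zd

/-! ### Tight U-turns and their window-locality -/

/-- A **tight U-turn (hairpin)** at step `j` of the `N`-step walk `ω` on `ℤ^{d+2}`: the steps `j→j+1`,
`j+1→j+2`, `j+2→j+3` satisfy "third = minus first", `ω(j+3) − ω(j+2) = ω(j) − ω(j+1)` (the pattern
`(e, f, -e)`; on a self-avoiding walk `f ⊥ e`). An event family in the format of `Zd.lemma725`.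
[cite: MadrasSlade1993, §7.2 (patterns; Theorem 7.2.3)] -/
def hairpinAt {d : ℕ} (N : ℕ) (ω : ℕ → Site (d + 2)) (j : ℕ) : Prop :=
  j + 3 ≤ N ∧ ω (j + 3) - ω (j + 2) = ω j - ω (j + 1)

/-- `hairpinAt` has the **restriction property** of Lemma 7.2.5 at every block length `m`, in every
dimension: a U-turn of the block `subwalk ω a m` at step `j` is a U-turn of `ω` at step `a + j`
(the subwalk is a translate of `ω (a + ·)` on `[0, m]`, so step differences are preserved).
[cite: MadrasSlade1993, Lemma 7.2.5 (restriction property of localized events)] -/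
theorem restricts_hairpinAt (d m : ℕ) : Restricts (d := d) hairpinAt m := by
  intro N ω _hω a ha j hj h
  obtain ⟨hj3, heq⟩ := h
  refine ⟨by omega, ?_⟩
  rw [subwalk_apply hj3, subwalk_apply (by omega : j + 2 ≤ m), subwalk_apply hj,
    subwalk_apply (by omega : j + 1 ≤ m)] at heq
  rw [show a + j + 3 = a + (j + 3) by omega, show a + j + 2 = a + (j + 2) by omega,
    show a + j + 1 = a + (j + 1) by omega]
  calc ω (a + (j + 3)) - ω (a + (j + 2))
      = (-ω a + ω (a + (j + 3))) - (-ω a + ω (a + (j + 2))) := by abel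
    _ = (-ω a + ω (a + j)) - (-ω a + ω (a + (j + 1))) := heq
    _ = ω (a + j) - ω (a + (j + 1)) := by abel

end Zd

/-! ### U-turn-free step words and the 2-state automaton recursion -/

/-- **Admissible step words** (read from the front): no immediate reversal (`b ≠ a + 2` for consecutive letters
`a, b`) and no tight hairpin (`c ≠ a + 2` for letters `a, b, c` in a row). [folklore] -/
def UTurnFree : List Step → Prop
  | a :: b :: c :: w => b ≠ a + 2 ∧ c ≠ a + 2 ∧ UTurnFree (b :: c :: w)
  | [a, b] => b ≠ a + 2
  | [_] => True
  | [] => True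

/-- `UTurnFree []`. [folklore] -/
@[simp] private theorem uTurnFree_nil : UTurnFree [] := trivial

/-- `UTurnFree [a]`. [folklore] -/
@[simp] private theorem uTurnFree_single (a : Step) : UTurnFree [a] := trivial

/-- `UTurnFree [a, b] ↔ b ≠ a + 2`. [folklore] -/
private theorem uTurnFree_pair (a b : Step) : UTurnFree [a, b] ↔ b ≠ a + 2 := Iff.rfl

/-- The three-letter unfolding of `UTurnFree`. [folklore] -/
private theorem uTurnFree_cons₃ (a b c : Step) (w : List Step) :
    UTurnFree (a :: b :: c :: w) ↔ b ≠ a + 2 ∧ c ≠ a + 2 ∧ UTurnFree (b :: c :: w) := Iff.rfl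

/-- An admissible word of length `≥ 2` does not start with a reversal. [folklore] -/
private theorem UTurnFree.ne_of_cons₂ {b c : Step} {w : List Step} (h : UTurnFree (b :: c :: w)) : c ≠ b + 2 := by
  cases w with
  | nil => exact h
  | cons d w => exact h.1

/-- An admissible word is still admissible behind a doubled first letter, and conversely. [folklore] -/
private theorem uTurnFree_cons_self_iff (b : Step) (w : List Step) : UTurnFree (b :: b :: w) ↔ UTurnFree (b :: w) := by
  have hb : b ≠ b + 2 := by revert b; decide
  cases w with
  | nil => simp only [uTurnFree_pair, uTurnFree_single, iff_true]; exact hb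
  | cons c w =>
    rw [uTurnFree_cons₃]
    constructor
    · rintro ⟨-, -, h⟩; exact h
    · intro h; exact ⟨hb, h.ne_of_cons₂, h⟩

/-- The tail of an admissible word is admissible. [folklore] -/
private theorem UTurnFree.tail {a : Step} {w : List Step} (h : UTurnFree (a :: w)) : UTurnFree w := by
  match w, h with
  | [], _ => trivial
  | [b], _ => trivial
  | b :: c :: w, h => exact h.2.2

open Classical in
/-- The admissible step words of length `n`. [folklore] -/
noncomputable def uTurnFreeWords (n : ℕ) : Finset (List Step) := (words n).filter UTurnFree

/-- `words 0 = {[]}`. [folklore] -/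
private theorem words_zero : words 0 = {[]} := by
  ext w
  simp [mem_words, List.length_eq_zero_iff]

/-- `words (n+1)` is obtained from `words n` by prepending one letter. [folklore] -/
private theorem words_succ_eq_image (n : ℕ) :
    words (n + 1) = ((univ : Finset Step) ×ˢ words n).image fun p => p.1 :: p.2 := by
  ext w
  simp only [mem_words, mem_image, mem_product, mem_univ, true_and, Prod.exists]
  constructor
  · intro h
    cases w with
    | nil => simp at h
    | cons d w' => exact ⟨d, w', by simpa using h, rfl⟩
  · rintro ⟨d, w', hw', rfl⟩
    simp [hw']

/-- **First-letter decomposition of sums over words**: `Σ_{|w| = n+1} f(w) = Σ_{|w| = n} Σ_d f(d :: w)`. [folklore] -/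
private theorem sum_words_succ_cons {M : Type*} [AddCommMonoid M] (n : ℕ) (f : List Step → M) :
    ∑ w ∈ words (n + 1), f w = ∑ w ∈ words n, ∑ d : Step, f (d :: w) := by
  rw [words_succ_eq_image, sum_image, sum_product, sum_comm]
  rintro ⟨d, w⟩ _ ⟨d', w'⟩ _ h
  simp only [List.cons.injEq] at h
  exact Prod.ext h.1 h.2

open Classical in
/-- `#uTurnFreeWords n` as an indicator sum. [folklore] -/
private theorem card_uTurnFreeWords_eq_sum (n : ℕ) : (uTurnFreeWords n).card = ∑ w ∈ words n, if UTurnFree w then 1 else 0 := by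
  rw [uTurnFreeWords, card_filter]

/-- Words starting with a doubled letter that are admissible. [folklore] -/
def UTurnFreeDbl : List Step → Prop
  | a :: b :: w => a = b ∧ UTurnFree (a :: b :: w)
  | _ => False

/-- Fiber count, first kind: for `c ≠ b + 2`, the number of letters `a` with `b ≠ a + 2` and `c ≠ a + 2` is
`3` if `b = c` and `2` otherwise. [folklore] -/
private theorem sum_ite_ne_ne (b c : Step) (hbc : c ≠ b + 2) :
    (∑ a : Step, if b ≠ a + 2 ∧ c ≠ a + 2 then 1 else 0) = if b = c then 3 else 2 := by
  revert b c
  decide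

open Classical in
/-- Fiber count over an admissible word of length `≥ 2`:
`Σ_a 𝟙[UTurnFree (a :: v)] = 2·𝟙[UTurnFree v] + 𝟙[UTurnFreeDbl v]`. [folklore] -/
private theorem sum_ite_uTurnFree_cons (b c : Step) (v : List Step) :
    (∑ a : Step, if UTurnFree (a :: b :: c :: v) then 1 else 0) =
      2 * (if UTurnFree (b :: c :: v) then 1 else 0) + (if UTurnFreeDbl (b :: c :: v) then 1 else 0) := by
  by_cases hv : UTurnFree (b :: c :: v)
  · have hbc : c ≠ b + 2 := hv.ne_of_cons₂
    have e : ∀ a : Step, (UTurnFree (a :: b :: c :: v)) ↔ (b ≠ a + 2 ∧ c ≠ a + 2) := fun a => by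
      rw [uTurnFree_cons₃]; exact ⟨fun h => ⟨h.1, h.2.1⟩, fun h => ⟨h.1, h.2, hv⟩⟩
    simp_rw [e]
    rw [sum_ite_ne_ne b c hbc]
    simp only [UTurnFreeDbl, hv, and_true, if_true]
    split_ifs <;> rfl
  · have e : ∀ a : Step, ¬ UTurnFree (a :: b :: c :: v) := fun a h => hv h.2.2
    simp [e, UTurnFreeDbl, hv]

open Classical in
/-- Fiber count, second kind: `Σ_a 𝟙[UTurnFreeDbl (a :: b :: v')] = 𝟙[UTurnFree (b :: v')]`. [folklore] -/
private theorem sum_ite_dbl_cons (b : Step) (v' : List Step) :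
    (∑ a : Step, if UTurnFreeDbl (a :: b :: v') then 1 else 0) = if UTurnFree (b :: v') then 1 else 0 := by
  have e : ∀ a : Step, UTurnFreeDbl (a :: b :: v') ↔ (a = b ∧ UTurnFree (b :: v')) := fun a => by
    show (a = b ∧ UTurnFree (a :: b :: v')) ↔ _
    constructor
    · rintro ⟨rfl, h⟩; exact ⟨rfl, (uTurnFree_cons_self_iff a v').1 h⟩
    · rintro ⟨rfl, h⟩; exact ⟨rfl, (uTurnFree_cons_self_iff a v').2 h⟩
  simp_rw [e]
  rw [Finset.sum_ite, Finset.sum_const_zero, add_zero, Finset.sum_const, smul_eq_mul, mul_one]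
  by_cases h : UTurnFree (b :: v')
  · rw [if_pos h]
    have : (univ.filter fun a : Step => a = b ∧ UTurnFree (b :: v')) = {b} := by
      ext a; simp [h]
    rw [this, card_singleton]
  · rw [if_neg h]
    have : (univ.filter fun a : Step => a = b ∧ UTurnFree (b :: v')) = ∅ := by
      ext a; simp [h]
    rw [this, card_empty]

open Classical in
/-- **Claim 1**: for `n ≥ 1`, `Σ_{|w| = n+1} 𝟙[UTurnFreeDbl w] = #uTurnFreeWords n` (drop the doubled first letter). [folklore] -/
private theorem sum_dbl_succ (n : ℕ) (hn : 1 ≤ n) :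
    (∑ w ∈ words (n + 1), if UTurnFreeDbl w then 1 else 0) = (uTurnFreeWords n).card := by
  rw [sum_words_succ_cons, card_uTurnFreeWords_eq_sum]
  refine sum_congr rfl fun v hv => ?_
  rw [mem_words] at hv
  cases v with
  | nil => simp at hv; omega
  | cons b v' => exact sum_ite_dbl_cons b v'

open Classical in
/-- **Claim 2**: for `n ≥ 2`, `#uTurnFreeWords (n+1) = 2·#uTurnFreeWords n + Σ_{|w| = n} 𝟙[UTurnFreeDbl w]`. [folklore] -/
private theorem card_uTurnFreeWords_succ (n : ℕ) (hn : 2 ≤ n) :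
    (uTurnFreeWords (n + 1)).card = 2 * (uTurnFreeWords n).card + ∑ w ∈ words n, if UTurnFreeDbl w then 1 else 0 := by
  rw [card_uTurnFreeWords_eq_sum, card_uTurnFreeWords_eq_sum, sum_words_succ_cons, mul_sum, ← sum_add_distrib]
  refine sum_congr rfl fun v hv => ?_
  rw [mem_words] at hv
  match v, hv with
  | [], hv => simp at hv; omega
  | [b], hv => simp at hv; omega
  | b :: c :: v'', _ => exact sum_ite_uTurnFree_cons b c v''

/-- **The automaton recursion** `#uTurnFreeWords (n+3) = 2·#uTurnFreeWords (n+2) + #uTurnFreeWords (n+1)`. [folklore] -/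
private theorem card_uTurnFreeWords_rec (n : ℕ) :
    (uTurnFreeWords (n + 3)).card = 2 * (uTurnFreeWords (n + 2)).card + (uTurnFreeWords (n + 1)).card := by
  classical
  rw [card_uTurnFreeWords_succ (n + 2) (by omega), sum_dbl_succ (n + 1) (by omega)]

/-- `#uTurnFreeWords 1 = 4`. [folklore] -/
private theorem card_uTurnFreeWords_one : (uTurnFreeWords 1).card = 4 := by
  classical
  rw [card_uTurnFreeWords_eq_sum, sum_words_succ_cons, words_zero, sum_singleton]
  simp

/-- `#uTurnFreeWords 2 = 12`. [folklore] -/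
private theorem card_uTurnFreeWords_two : (uTurnFreeWords 2).card = 12 := by
  classical
  rw [card_uTurnFreeWords_eq_sum, sum_words_succ_cons, sum_words_succ_cons, words_zero, sum_singleton]
  simp only [uTurnFree_pair]
  decide

/-- The sequence `4, 12, 28, 68, 164, 396, 956, 2308, 5572, 13452, …` (`w_{n+1}` = number of admissible words of
length `n+1`; `w_m = 2[(1+√2)^m + (1-√2)^m]`). [folklore] -/
def uTurnFreeSeq : ℕ → ℕ
  | 0 => 4
  | 1 => 12
  | n + 2 => 2 * uTurnFreeSeq (n + 1) + uTurnFreeSeq n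

/-- `#uTurnFreeWords (n+1) = uTurnFreeSeq n`. [folklore] -/
private theorem card_uTurnFreeWords_eq_uTurnFreeSeq (n : ℕ) :
    (uTurnFreeWords (n + 1)).card = uTurnFreeSeq n ∧ (uTurnFreeWords (n + 2)).card = uTurnFreeSeq (n + 1) := by
  induction n with
  | zero => exact ⟨card_uTurnFreeWords_one, card_uTurnFreeWords_two⟩
  | succ n ih =>
    refine ⟨ih.2, ?_⟩
    rw [show n + 1 + 2 = n + 3 by omega, card_uTurnFreeWords_rec, ih.2, ih.1]
    rfl

/-- **`#uTurnFreeWords 10 = 13 452`**. [folklore] -/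
private theorem card_uTurnFreeWords_ten : (uTurnFreeWords 10).card = 13452 := by
  rw [(card_uTurnFreeWords_eq_uTurnFreeSeq 9).1]
  rfl

/-! ### Hairpin-free self-avoiding walks inject into U-turn-free words -/

/-- The index characterisation implies admissibility. [folklore] -/
private theorem uTurnFree_of_index : ∀ (w : List Step),
    (∀ i (hi : i + 1 < w.length), w[i + 1] ≠ w[i] + 2) →
    (∀ i (hi : i + 2 < w.length), w[i + 2] ≠ w[i] + 2) → UTurnFree w
  | [], _, _ => trivial
  | [_], _, _ => trivial
  | [a, b], h1, _ => by
    have := h1 0 (by simp)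
    exact (uTurnFree_pair a b).2 (by simpa using this)
  | a :: b :: c :: w, h1, h2 => by
    refine ⟨?_, ?_, uTurnFree_of_index (b :: c :: w) ?_ ?_⟩
    · have := h1 0 (by simp); simpa using this
    · have := h2 0 (by simp); simpa using this
    · intro i hi
      have := h1 (i + 1) (by simp only [List.length_cons] at hi ⊢; omega)
      simpa using this
    · intro i hi
      have := h2 (i + 1) (by simp only [List.length_cons] at hi ⊢; omega)
      simpa using this

/-- Opposite directions have opposite unit steps: `vec (a + 2) = - vec a`. [folklore] -/
private theorem Step.vec_add_two (a : Step) : Step.vec (a + 2) = -Step.vec a := by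
  fin_cases a <;> (ext j; fin_cases j <;> rfl)

/-- The step word of a hairpin-free `m`-step self-avoiding walk on `ℤ²` is admissible. [folklore] -/
private theorem uTurnFree_wordOf {m : ℕ} {ω : ℕ → Site 2} (hω : ω ∈ Zd.goodWalks (d := 0) Zd.hairpinAt m) :
    UTurnFree (wordOf m ω) := by
  classical
  unfold Zd.goodWalks at hω
  rw [Finset.mem_filter] at hω
  obtain ⟨hs, hgood⟩ := hω
  have hinj := (Zd.mem_saws.1 hs).2.2.2
  have hlen : (wordOf m ω).length = m := length_wordOf m ω
  have htraj : traj (wordOf m ω) = ω := traj_wordOf hs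
  have hstep : ∀ i (hi : i < (wordOf m ω).length), ω (i + 1) = ω i + Step.vec ((wordOf m ω)[i]) := by
    intro i hi
    have := traj_succ (wordOf m ω) hi
    rwa [htraj] at this
  refine uTurnFree_of_index (wordOf m ω) (fun i hi hrev => ?_) (fun i hi hhp => ?_)
  · -- an immediate reversal returns to `ω i` at time `i + 2`
    have h2 : ω (i + 2) = ω i := by
      rw [show i + 2 = i + 1 + 1 by omega, hstep (i + 1) hi, hstep i (by omega), hrev, Step.vec_add_two]
      abel
    have := hinj (show i + 2 ≤ m by rw [hlen] at hi; omega) (show i ≤ m by rw [hlen] at hi; omega) h2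
    omega
  · -- a factor `(a, b, a + 2)` is a tight hairpin at step `i`
    refine hgood i (by rw [hlen] at hi; omega) ⟨by rw [hlen] at hi; omega, ?_⟩
    rw [show i + 3 = i + 2 + 1 by omega, hstep (i + 2) hi, hstep i (by omega), hhp, Step.vec_add_two]
    abel

/-- **Hairpin-free walks inject into admissible words** (by `wordOf`, inverted by `traj`). [folklore] -/
private theorem card_goodWalks_le_card_uTurnFreeWords (m : ℕ) :
    (Zd.goodWalks (d := 0) Zd.hairpinAt m).card ≤ (uTurnFreeWords m).card := by
  classical
  refine Finset.card_le_card_of_injOn (wordOf m) (fun ω hω => ?_) (fun ω hω ω' hω' h => ?_)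
  · rw [Finset.mem_coe] at hω
    rw [Finset.mem_coe, uTurnFreeWords, Finset.mem_filter, mem_words]
    exact ⟨length_wordOf m ω, uTurnFree_wordOf hω⟩
  · rw [Finset.mem_coe] at hω hω'
    unfold Zd.goodWalks at hω hω'
    rw [Finset.mem_filter] at hω hω'
    rw [← traj_wordOf hω.1, ← traj_wordOf hω'.1, h]

/-- **`#(hairpin-free 10-step SAWs of ℤ²) ≤ 13 452`**. [folklore] -/
private theorem card_goodWalks_hairpin_ten_le : (Zd.goodWalks (d := 0) Zd.hairpinAt 10).card ≤ 13452 :=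
  (card_goodWalks_le_card_uTurnFreeWords 10).trans card_uTurnFreeWords_ten.le


/-! ### Lemma 7.2.5 with its constants exposed -/

/-- **Madras–Slade Lemma 7.2.5 with explicit constants.** If `X` has the restriction property at block length
`m ≥ 1`, `#{β ∈ S_m : X never occurs} ≤ y·μ^m` with `y < 1`, `c_m ≤ x·μ^m`, and `q₂` satisfies
`((1+y)/2)^{q₂} ≤ (1-y)/(4x)`, then with `Q = m·q₂` and `C = Σ_{r<m} c_r`, for every `N`,
`#{ω ∈ S_N : occ_X(ω) ≤ N/(4Q)} ≤ C · 2^{-⌊N/Q⌋} · μ^N`.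
(`Zd.lemma725` is this with `x = c_m/μ^m`, `y = #good/μ^m` and some `q₂`; same proof — the block
decomposition (7.2.5), `card_few_badBlocks_le`, and the exponential Chebyshev bound
`sum_filter_card_le_chernoff` — with the identity `λ c_m + #good = z μ^m` weakened to `≤`.)
[cite: MadrasSlade1993, Lemma 7.2.5] -/
theorem Zd.lemma725_explicit {d : ℕ} {X : ℕ → (ℕ → Site (d + 2)) → ℕ → Prop} {m : ℕ} (hm : 0 < m)
    (hR : Zd.Restricts X m) {x y : ℝ} (hy1 : y < 1)
    (hG : ((Zd.goodWalks X m).card : ℝ) ≤ y * Zd.connectiveConstant (d + 2) ^ m)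
    (hc : (Zd.count (d + 2) m : ℝ) ≤ x * Zd.connectiveConstant (d + 2) ^ m)
    {q₂ : ℕ} (hq : ((1 + y) / 2) ^ q₂ ≤ (1 - y) / (4 * x)) {Q : ℕ} (hQ : Q = m * q₂) (N : ℕ) :
    (((Zd.saws (d + 2) N).filter fun ω => Zd.occ X N ω ≤ N / (4 * Q)).card : ℝ) ≤
      (∑ r ∈ Finset.range m, (Zd.count (d + 2) r : ℝ)) * (1 / 2) ^ (N / Q) *
        Zd.connectiveConstant (d + 2) ^ N := by
  classical
  subst hQ
  have hμ1 : 1 ≤ Zd.connectiveConstant (d + 2) := Zd.one_le_connectiveConstant (d + 2)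
  have hμpos : 0 < Zd.connectiveConstant (d + 2) := by linarith
  have hμm : 0 < Zd.connectiveConstant (d + 2) ^ m := by positivity
  have hG0 : 0 ≤ ((Zd.goodWalks X m).card : ℝ) := by positivity
  have hcm_ge : Zd.connectiveConstant (d + 2) ^ m ≤ (Zd.count (d + 2) m : ℝ) := by
    have h0 := Zd.connectiveConstant_le_rpow (d := d + 2) (n := m) (by omega)
    have h := Real.rpow_le_rpow (by linarith) h0 (show (0 : ℝ) ≤ m by positivity)
    rw [← Real.rpow_natCast (Zd.connectiveConstant (d + 2)) m]
    refine h.trans (le_of_eq ?_)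
    rw [← Real.rpow_mul (by positivity), one_div_mul_cancel (by exact_mod_cast hm.ne'), Real.rpow_one]
  have hcm_pos : 0 < (Zd.count (d + 2) m : ℝ) := hμm.trans_le hcm_ge
  -- `x ≥ 1` and `y ≥ 0` follow from the hypotheses
  have hx1 : 1 ≤ x := by
    have : 1 * Zd.connectiveConstant (d + 2) ^ m ≤ x * Zd.connectiveConstant (d + 2) ^ m := by
      rw [one_mul]; exact hcm_ge.trans hc
    exact le_of_mul_le_mul_right this hμm
  have hy0 : 0 ≤ y := by
    by_contra h
    push Not at h
    have : y * Zd.connectiveConstant (d + 2) ^ m < 0 := mul_neg_of_neg_of_pos h hμm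
    linarith
  obtain ⟨lam, hlam⟩ : ∃ lam : ℝ, lam = (1 - y) / (2 * x) := ⟨_, rfl⟩
  have hlam_pos : 0 < lam := by rw [hlam]; apply div_pos <;> linarith
  have hlam1 : lam ≤ 1 := by rw [hlam, div_le_one (by linarith)]; linarith
  obtain ⟨z, hz⟩ : ∃ z : ℝ, z = (1 + y) / 2 := ⟨_, rfl⟩
  have hz0 : 0 ≤ z := by rw [hz]; linarith
  have hz1 : z < 1 := by rw [hz]; linarith
  have hzsum : lam * (Zd.count (d + 2) m : ℝ) + ((Zd.goodWalks X m).card : ℝ) ≤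
      z * Zd.connectiveConstant (d + 2) ^ m := by
    calc lam * (Zd.count (d + 2) m : ℝ) + ((Zd.goodWalks X m).card : ℝ)
        ≤ lam * (x * Zd.connectiveConstant (d + 2) ^ m) + y * Zd.connectiveConstant (d + 2) ^ m :=
          add_le_add (mul_le_mul_of_nonneg_left hc hlam_pos.le) hG
      _ = z * Zd.connectiveConstant (d + 2) ^ m := by
          rw [hlam, hz]
          have hx0 : x ≠ 0 := by linarith
          field_simp
          ring
  have hsum0 : 0 ≤ lam * (Zd.count (d + 2) m : ℝ) + ((Zd.goodWalks X m).card : ℝ) := by positivity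
  -- `z^{q₂} ≤ λ/2`
  have hzq : z ^ q₂ ≤ lam / 2 := by
    have : lam / 2 = (1 - y) / (4 * x) := by
      rw [hlam]
      have hx0 : x ≠ 0 := by linarith
      field_simp
      ring
    rw [hz, this]
    exact hq
  have hK'M : N / (m * q₂) = N / m / q₂ := (Nat.div_div_eq_div_mul N m q₂).symm
  -- step a: few occurrences ⇒ few bad blocks
  have hsub : ((Zd.saws (d + 2) N).filter fun ω => Zd.occ X N ω ≤ N / (4 * (m * q₂))) ⊆
      (Zd.saws (d + 2) N).filter fun ω => (Zd.badBlocks X m N ω).card ≤ N / (m * q₂) := by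
    intro ω hω
    rw [Finset.mem_filter] at hω ⊢
    refine ⟨hω.1, (Zd.card_badBlocks_le hR hm hω.1).trans ?_⟩
    have : N / (4 * (m * q₂)) = N / (m * q₂) / 4 := by rw [mul_comm 4, ← Nat.div_div_eq_div_mul]
    rw [this] at hω
    omega
  have h1 : (((Zd.saws (d + 2) N).filter fun ω => Zd.occ X N ω ≤ N / (4 * (m * q₂))).card : ℝ) ≤
      ((Zd.saws (d + 2) N).filter fun ω => (Zd.badBlocks X m N ω).card ≤ N / (m * q₂)).card :=
    Nat.cast_le.2 (Finset.card_le_card hsub)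
  -- step b: the block decomposition and the Chernoff bound
  have hb : (((Zd.saws (d + 2) N).filter fun ω => (Zd.badBlocks X m N ω).card ≤ N / (m * q₂)).card : ℝ) ≤
      (∑ I ∈ (Finset.univ : Finset (Fin (N / m))).powerset.filter (fun I => I.card ≤ N / (m * q₂)),
          (Zd.count (d + 2) m : ℝ) ^ I.card * ((Zd.goodWalks X m).card : ℝ) ^ (N / m - I.card)) *
        (Zd.count (d + 2) (N % m) : ℝ) := by
    have h0 := (Nat.cast_le (α := ℝ)).2 (Zd.card_few_badBlocks_le (X := X) (m := m) N (N / (m * q₂)))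
    push_cast at h0
    rw [Finset.sum_mul]
    exact h0
  have hch := Zd.sum_filter_card_le_chernoff (N / m) (N / (m * q₂)) hcm_pos.le hG0 hlam_pos hlam1
  have hcr : (Zd.count (d + 2) (N % m) : ℝ) ≤ ∑ r ∈ Finset.range m, (Zd.count (d + 2) r : ℝ) :=
    Finset.single_le_sum (f := fun r => (Zd.count (d + 2) r : ℝ)) (fun _ _ => Nat.cast_nonneg _)
      (Finset.mem_range.2 (Nat.mod_lt N hm))
  have hC₀0 : 0 ≤ ∑ r ∈ Finset.range m, (Zd.count (d + 2) r : ℝ) := Finset.sum_nonneg fun _ _ => Nat.cast_nonneg _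
  -- step c: `(1/λ)^{K'} z^M ≤ (1/2)^{K'}` and `μ^{mM} ≤ μ^N`
  have hMq : q₂ * (N / (m * q₂)) ≤ N / m := by
    rw [hK'M, mul_comm]; exact Nat.div_mul_le_self (N / m) q₂
  have hlam0 : 0 ≤ 1 / lam := by positivity
  have hd : (1 / lam) ^ (N / (m * q₂)) * z ^ (N / m) ≤ (1 / 2) ^ (N / (m * q₂)) := by
    calc (1 / lam) ^ (N / (m * q₂)) * z ^ (N / m) ≤ (1 / lam) ^ (N / (m * q₂)) * z ^ (q₂ * (N / (m * q₂))) :=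
          mul_le_mul_of_nonneg_left (pow_le_pow_of_le_one hz0 hz1.le hMq) (pow_nonneg hlam0 _)
      _ = ((1 / lam) * z ^ q₂) ^ (N / (m * q₂)) := by rw [mul_pow, ← pow_mul]
      _ ≤ (1 / 2) ^ (N / (m * q₂)) := by
          apply pow_le_pow_left₀ (mul_nonneg hlam0 (pow_nonneg hz0 _))
          rw [one_div_mul_eq_div, div_le_iff₀ hlam_pos]
          linarith
  have he : (Zd.connectiveConstant (d + 2) ^ m) ^ (N / m) ≤ Zd.connectiveConstant (d + 2) ^ N := by
    rw [← pow_mul]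
    exact pow_le_pow_right₀ hμ1 (by rw [mul_comm]; exact Nat.div_mul_le_self N m)
  have hpos1 : 0 ≤ (1 / lam) ^ (N / (m * q₂)) *
      (lam * (Zd.count (d + 2) m : ℝ) + ((Zd.goodWalks X m).card : ℝ)) ^ (N / m) :=
    mul_nonneg (pow_nonneg hlam0 _) (pow_nonneg hsum0 _)
  calc (((Zd.saws (d + 2) N).filter fun ω => Zd.occ X N ω ≤ N / (4 * (m * q₂))).card : ℝ)
      ≤ (∑ I ∈ (Finset.univ : Finset (Fin (N / m))).powerset.filter (fun I => I.card ≤ N / (m * q₂)),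
          (Zd.count (d + 2) m : ℝ) ^ I.card * ((Zd.goodWalks X m).card : ℝ) ^ (N / m - I.card)) *
        (Zd.count (d + 2) (N % m) : ℝ) := h1.trans hb
    _ ≤ ((1 / lam) ^ (N / (m * q₂)) *
          (lam * (Zd.count (d + 2) m : ℝ) + ((Zd.goodWalks X m).card : ℝ)) ^ (N / m)) *
        ∑ r ∈ Finset.range m, (Zd.count (d + 2) r : ℝ) :=
        mul_le_mul hch hcr (Nat.cast_nonneg _) hpos1
    _ ≤ ((1 / lam) ^ (N / (m * q₂)) * (z * Zd.connectiveConstant (d + 2) ^ m) ^ (N / m)) *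
        ∑ r ∈ Finset.range m, (Zd.count (d + 2) r : ℝ) :=
        mul_le_mul_of_nonneg_right
          (mul_le_mul_of_nonneg_left (pow_le_pow_left₀ hsum0 hzsum _) (pow_nonneg hlam0 _)) hC₀0
    _ = (∑ r ∈ Finset.range m, (Zd.count (d + 2) r : ℝ)) * ((1 / lam) ^ (N / (m * q₂)) * z ^ (N / m)) *
        (Zd.connectiveConstant (d + 2) ^ m) ^ (N / m) := by rw [mul_pow]; ring
    _ ≤ (∑ r ∈ Finset.range m, (Zd.count (d + 2) r : ℝ)) * (1 / 2) ^ (N / (m * q₂)) *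
        Zd.connectiveConstant (d + 2) ^ N :=
        mul_le_mul (mul_le_mul_of_nonneg_left hd hC₀0) he (pow_nonneg hμm.le _)
          (mul_nonneg hC₀0 (pow_nonneg (by norm_num) _))

/-- `uTurnFreeSeq 19 = 90 478 148` (`= #uTurnFreeWords 20`). [folklore] -/
private theorem uTurnFreeSeq_nineteen : uTurnFreeSeq 19 = 90478148 := by rfl

/-- **`#(hairpin-free 20-step SAWs of ℤ²) ≤ 90 478 148`**. [folklore] -/
private theorem card_goodWalks_hairpin_twenty_le : (Zd.goodWalks (d := 0) Zd.hairpinAt 20).card ≤ 90478148 :=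
  (card_goodWalks_le_card_uTurnFreeWords 20).trans ((card_uTurnFreeWords_eq_uTurnFreeSeq 19).1.trans uTurnFreeSeq_nineteen).le

/-- `2.604^n ≤ μ(ℤ²)^n`. [folklore] -/
private theorem pow_le_connectiveConstant_pow_2604 (n : ℕ) : (2.604 : ℝ) ^ n ≤ Zd.connectiveConstant 2 ^ n := by
  rw [Zd.connectiveConstant_two]
  exact pow_le_pow_left₀ (by norm_num) le_connectiveConstant_2604 n


/-! ### The pattern theorem for tight U-turns on `ℤ²` -/

/-- **`#{hairpin-free 10-step SAWs of ℤ²} < μ(ℤ²)^10`** (`≤ 13 452 < 14 335.4… = 2.604^10 ≤ μ^10`):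
the hypothesis "`lim inf c_N[0,E]^{1/N} < μ`" of Lemma 7.2.5 for the U-turn event, at `m = 10`. [folklore] -/
private theorem Zd.card_goodWalks_hairpinAt_ten_lt :
    ((Zd.goodWalks (d := 0) Zd.hairpinAt 10).card : ℝ) < Zd.connectiveConstant 2 ^ 10 := by
  have h1 : ((Zd.goodWalks (d := 0) Zd.hairpinAt 10).card : ℝ) ≤ 13452 := by
    exact_mod_cast card_goodWalks_hairpin_ten_le
  have h2 : (13452 : ℝ) < (2.604 : ℝ) ^ 10 := by norm_num
  linarith [pow_le_connectiveConstant_pow_2604 10]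

/-- **Kesten's pattern theorem for tight U-turns on `ℤ²`** (Madras–Slade Theorem 7.2.3 for the pattern
`(e, f, -e)`, in the exponential form of Lemma 7.2.5): there are `Q > 0` and `C` such that for every `N`
the number of `N`-step self-avoiding walks with at most `N/(4Q)` tight U-turns is at most
`C · 2^{-⌊N/Q⌋} · μ^N` (so `lim sup c_N[N/(4Q), U-turn]^{1/N} ≤ 2^{-1/Q} μ < μ`). The printed theorem
asserts `∃ a > 0`; here the instance is unconditional and certificate-free beyond `μ(ℤ²) ≥ 2.604`.
[cite: MadrasSlade1993, Theorem 7.2.3 (instance: the U-turn pattern on ℤ²)] -/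
theorem Zd.hairpin_density :
    ∃ Q : ℕ, 0 < Q ∧ ∃ C : ℝ, ∀ N : ℕ,
      (((Zd.saws 2 N).filter fun ω => Zd.occ Zd.hairpinAt N ω ≤ N / (4 * Q)).card : ℝ) ≤
        C * (1 / 2) ^ (N / Q) * Zd.connectiveConstant 2 ^ N :=
  Zd.lemma725 (by norm_num) (Zd.restricts_hairpinAt 0 10) Zd.card_goodWalks_hairpinAt_ten_lt

/-- **Kesten's pattern theorem for tight U-turns on `ℤ²`, explicit constants** (block length `m = 20`,
`q₂ = 16`, `Q = 320`, `C = Σ_{r<20} c_r`): for every `N`,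
`#{ω ∈ S_N : #U-turns ≤ N/1280} ≤ (Σ_{r<20} c_r) · 2^{-⌊N/320⌋} · μ^N`.
Inputs: `#goodWalks hairpinAt 20 ≤ 90 478 148 ≤ 0.441·2.604^20`, `c_20 ≤ 4·3^19 ≤ 22.7·2.604^20`
(`Zd.count_succ_le`), `0.7205^16 ≤ 0.559/90.8`. The constants are this formalisation's.
[cite: MadrasSlade1993, Theorem 7.2.3 (instance: the U-turn pattern on ℤ², via Lemma 7.2.5)] -/
theorem Zd.hairpin_density_explicit (N : ℕ) :
    (((Zd.saws 2 N).filter fun ω => Zd.occ Zd.hairpinAt N ω ≤ N / (4 * 320)).card : ℝ) ≤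
      (∑ r ∈ Finset.range 20, (Zd.count 2 r : ℝ)) * (1 / 2) ^ (N / 320) * Zd.connectiveConstant 2 ^ N := by
  have h20 := pow_le_connectiveConstant_pow_2604 20
  have hG : ((Zd.goodWalks (d := 0) Zd.hairpinAt 20).card : ℝ) ≤ 0.441 * Zd.connectiveConstant 2 ^ 20 := by
    have h1 : ((Zd.goodWalks (d := 0) Zd.hairpinAt 20).card : ℝ) ≤ 90478148 := by
      exact_mod_cast card_goodWalks_hairpin_twenty_le
    have h2 : (90478148 : ℝ) ≤ 0.441 * (2.604 : ℝ) ^ 20 := by norm_num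
    exact h1.trans (h2.trans (mul_le_mul_of_nonneg_left h20 (by norm_num)))
  have hc : (Zd.count 2 20 : ℝ) ≤ 22.7 * Zd.connectiveConstant 2 ^ 20 := by
    have h0 : Zd.count 2 20 ≤ 4649045868 := by
      have := Zd.count_succ_le 2 19
      norm_num at this
      exact this
    have h1 : (Zd.count 2 20 : ℝ) ≤ 4649045868 := by exact_mod_cast h0
    have h2 : (4649045868 : ℝ) ≤ 22.7 * (2.604 : ℝ) ^ 20 := by norm_num
    exact h1.trans (h2.trans (mul_le_mul_of_nonneg_left h20 (by norm_num)))
  have hq : ((1 + (0.441 : ℝ)) / 2) ^ 16 ≤ (1 - 0.441) / (4 * 22.7) := by norm_num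
  exact Zd.lemma725_explicit (d := 0) (by norm_num) (Zd.restricts_hairpinAt 0 20) (by norm_num) hG hc hq
    (show 320 = 20 * 16 by norm_num) N

/-! ### Hairpin-free walks grow at most like `(1+√2)^m` (closed form of the automaton count; lane item KR-BR) -/

/-- `(1 + √2)² = 2 (1 + √2) + 1`. [folklore] -/
private theorem one_add_sqrt_two_sq : (1 + Real.sqrt 2) ^ 2 = 2 * (1 + Real.sqrt 2) + 1 := by
  have h : Real.sqrt 2 ^ 2 = 2 := Real.sq_sqrt (by norm_num)
  nlinarith [h]

/-- `uTurnFreeSeq n ≤ 3 (1+√2)^{n+1}` (two consecutive terms at once, for the two-step recursion). [folklore] -/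
private theorem uTurnFreeSeq_le_pow (n : ℕ) :
    (uTurnFreeSeq n : ℝ) ≤ 3 * (1 + Real.sqrt 2) ^ (n + 1) ∧
      (uTurnFreeSeq (n + 1) : ℝ) ≤ 3 * (1 + Real.sqrt 2) ^ (n + 2) := by
  have hs0 : (0 : ℝ) ≤ Real.sqrt 2 := Real.sqrt_nonneg 2
  have hs2 : Real.sqrt 2 ^ 2 = 2 := Real.sq_sqrt (by norm_num)
  have hs1 : (1 : ℝ) ≤ Real.sqrt 2 := by nlinarith [hs0, hs2]
  have hα : (0 : ℝ) ≤ 1 + Real.sqrt 2 := by linarith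
  induction n with
  | zero =>
    refine ⟨?_, ?_⟩
    · show ((4 : ℕ) : ℝ) ≤ 3 * (1 + Real.sqrt 2) ^ (0 + 1)
      rw [zero_add, pow_one]; push_cast; linarith
    · show ((12 : ℕ) : ℝ) ≤ 3 * (1 + Real.sqrt 2) ^ (0 + 2)
      rw [zero_add, one_add_sqrt_two_sq]; push_cast; linarith
  | succ n ih =>
    refine ⟨ih.2, ?_⟩
    have e : (uTurnFreeSeq (n + 1 + 1) : ℝ) = 2 * uTurnFreeSeq (n + 1) + uTurnFreeSeq n := by
      rw [show n + 1 + 1 = n + 2 by rfl, uTurnFreeSeq]; push_cast; ring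
    rw [e]
    have hp : (0 : ℝ) ≤ (1 + Real.sqrt 2) ^ (n + 1) := pow_nonneg hα _
    calc (2 : ℝ) * uTurnFreeSeq (n + 1) + uTurnFreeSeq n
        ≤ 2 * (3 * (1 + Real.sqrt 2) ^ (n + 2)) + 3 * (1 + Real.sqrt 2) ^ (n + 1) := by linarith [ih.1, ih.2]
      _ = 3 * (1 + Real.sqrt 2) ^ (n + 1) * (2 * (1 + Real.sqrt 2) + 1) := by ring
      _ = 3 * (1 + Real.sqrt 2) ^ (n + 1 + 2) := by rw [← one_add_sqrt_two_sq]; ring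

/-- **Hairpin-free self-avoiding walks on `ℤ²` are exponentially few at rate `1 + √2 < μ`**: for every `m`,
`#{ω ∈ S_m : no tight U-turn} ≤ 3 (1+√2)^m` (the hypothesis "`lim inf c_N[0,E]^{1/N} < μ`" of Lemma 7.2.5 for the
U-turn event in closed form: hairpin-free walks inject into U-turn-free words, counted by `uTurnFreeSeq`, whose
growth rate is `1 + √2`). [cite: MadrasSlade1993, Lemma 7.2.5 (hypothesis (7.2.18) for the U-turn event; closed form this file)] -/
theorem Zd.card_goodWalks_hairpinAt_le (m : ℕ) :
    ((Zd.goodWalks (d := 0) Zd.hairpinAt m).card : ℝ) ≤ 3 * (1 + Real.sqrt 2) ^ m := by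
  have hs0 : (0 : ℝ) ≤ Real.sqrt 2 := Real.sqrt_nonneg 2
  rcases Nat.eq_zero_or_pos m with rfl | hm
  · classical
    have h1 : (Zd.goodWalks (d := 0) Zd.hairpinAt 0).card ≤ 1 := by
      refine (card_goodWalks_le_card_uTurnFreeWords 0).trans ?_
      have : (uTurnFreeWords 0).card ≤ (words 0).card := by
        unfold uTurnFreeWords; convert Finset.card_filter_le (words 0) UTurnFree
      rw [card_words, pow_zero] at this
      exact this
    have h2 : ((Zd.goodWalks (d := 0) Zd.hairpinAt 0).card : ℝ) ≤ 1 := by exact_mod_cast h1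
    rw [pow_zero]; linarith
  · obtain ⟨n, rfl⟩ : ∃ n, m = n + 1 := ⟨m - 1, by omega⟩
    have h1 : ((Zd.goodWalks (d := 0) Zd.hairpinAt (n + 1)).card : ℝ) ≤ uTurnFreeSeq n := by
      have := (card_goodWalks_le_card_uTurnFreeWords (n + 1)).trans (card_uTurnFreeWords_eq_uTurnFreeSeq n).1.le
      exact_mod_cast this
    have h2 := (uTurnFreeSeq_le_pow n).1
    exact h1.trans h2


/-- **Hairpin-free walks versus the automaton count, exactly**: `#{ω ∈ S_{n+1} : no tight U-turn} ≤ uTurnFreeSeq n`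
(the injection `wordOf` into U-turn-free words; the count `uTurnFreeSeq` is this file's closed recursion, so block
constants for Lemma 7.2.5 at any block length are kernel evaluations — lane item X25 «K-ONLY»).
[cite: MadrasSlade1993, Lemma 7.2.5 (hypothesis (7.2.18) for the U-turn event; the count, this file)] -/
theorem Zd.card_goodWalks_hairpinAt_succ_le_uTurnFreeSeq (n : ℕ) :
    (Zd.goodWalks (d := 0) Zd.hairpinAt (n + 1)).card ≤ uTurnFreeSeq n :=
  (card_goodWalks_le_card_uTurnFreeWords (n + 1)).trans (card_uTurnFreeWords_eq_uTurnFreeSeq n).1.le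

end Literature.Probability.RandomPlanarGeometry.SAW
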